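import Summits.Ventures.LatticeQCDFlow.Scaling.ReplicaExchangeGraphSwap
import Summits.Ventures.LatticeQCDFlow.Scaling.ReplicaExchangeStarLegs
import Summits.Ventures.LatticeQCDFlow.Scaling.SpectralGapOfPoincare

/-!
HONEST FRAMING: exact (Metropolis-corrected) sampling algorithms for lattice gauge theory; figures
of merit are autocorrelation/cost numbers at stated couplings and volumes; no continuum-physics
claim.

# ReplicaExchangeStarFloor — THE STAR IS Θ(K²): FOR EVERY SWAP GRAPH WITH `m` EDGES CONTAINING THE HUB EDGES (the hot
# replica exchanges with every cold one; the star `m = K`, the complete graph `m = K(K+1)/2`)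
# `Gap ≥ 1/(3m(r²+1)/(t r⁴) + (K+1)(r³+3K)/(r³γ₀(1−t)))`, WITH ARBITRARY COLD UPDATES; STAR WITH IDENTICAL LEVELS:
# `Gap ≥ 1/(6K/t + (K+1)(3K+1)/(γ₀(1−t)))` — AGAINST THE CEILING `(1−t)Q_0(A,Aᶜ)/((K+1)Kv)` OF
# `Scaling/ReplicaExchangeGraphSwapDiffusive` (lean-2 GEN-19, ours)

Venture-side (OURS).  Cell `lqcd-flow` (pub-lqcd), unit `pub-lqcd-lean-2-g19`, 2026-08-25.  Chapter G.  The star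
sampler is `P = ptGraphSampler t μ M e 1` of `Scaling/ReplicaExchangeGraphSwap` with the `K` edges `e_k = (0, k+1)` and
identity maps; the legs are those of `Scaling/ReplicaExchangeStarLegs` (Efron–Stein over the product law plus the
length-three paths `x → x∘τ_k → (x∘τ_k)^{0←v} → x^{k+1←v}`); the bridge to the gap is
`Scaling/SpectralGapOfPoincare`.  Hypotheses: `0 < t < 1`, `K ≥ 1`, positive level laws with the two-sided ratio
`r·μ_0 ≤ μ_{k+1} ≤ μ_0/r` (`0 < r ≤ 1`), hot update `M_0` with Poincaré constant `γ₀`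
(`γ₀·Var_{μ_0}(h) ≤ 𝓔_{μ_0}(M_0;h)`), cold updates `M_k` ARBITRARY row-stochastic `μ_k`-reversible (even the identity).

## What is proved

* §1 `edgeFlowSwap_one` (identity maps: the edge swap is `x ∘ swap i l`); `update_succ_eq_conj_swap` (the star
  conveyor identity `x^{k+1←v} = ((x∘τ_k)^{0←v})∘τ_k`); `comp_starSwap_injOn`,
  **`half_sum_starSwap_le_dirichletForm`** (the hub swap edges are kept); the two flow formulas of a swap-graph
  sampler with `m` edges containing the hub edges (`hub_swap_flow_ge`: `π̃(x)P(x,x∘τ_k) ≥ (t/m)min{π̃(x),π̃(x∘τ_k)}`;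
  `hub_hot_flow_ge`: `π̃(x)P(x,x^{0←v}) ≥ ((1−t)/(K+1))π̃(x)M_0(x_0,v)`).
* §2 **`ptHub_poincare`** — `C·Var_π̃(f) ≤ 𝓔_π̃(P; f)` with `C = 1/(3m(r²+1)/(t r⁴) + (K+1)(r³+3K)/(r³γ₀(1−t)))` for
  every swap graph with `m` edges containing the hub edges `(0,k+1)`; **`ptHub_spectralGap_ge`** — `Gap(P) ≥ C`
  (the complete graph, `m = K(K+1)/2`, included: still order `K⁻²`); **`ptStar_spectralGap_ge`** — the star (`m = K`);
  **`ptStarIdentical_spectralGap_ge`** — identical levels: `Gap(P) ≥ 1/(6K/t + (K+1)(3K+1)/(γ₀(1−t)))`.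

Reading (no numerics implied): with sector-frozen cold replicas the ceiling of `ReplicaExchangeGraphSwapDiffusive` §4
is `(1−t)Q_0(A,Aᶜ)/((K+1)Kv)`, order `K⁻²`, and this floor is order `K⁻²`: a hot replica every cold replica reaches in
ONE accepted swap relaxes the ladder in `Θ(K²)` sampler steps — one power of `K` better than the adjacent ladder's
`Θ(K³)`, and no better (the tunnelling replica is updated one step in `K+1` and serves `K` clients); cold–cold edges
change neither order.  NOT CLAIMED: sharp constants; the flow-map version; anything measured.  Literature grade
(cell rule): OWN MECHANISM, NEW TYPING; nothing cited as a fact; no new bib keys.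
-/

noncomputable section

open Finset Function
open Literature.Probability.MarkovChains

namespace Summit.Ventures.LatticeQCDFlow.Scaling

variable {S : Type*} [Fintype S] [DecidableEq S] {K : ℕ} {μ : Fin (K + 1) → S → ℝ}
  {M : Fin (K + 1) → S → S → ℝ} {t : ℝ}

/-! ## §1 The star sampler: identity maps, kept flows, flow formulas -/

omit [Fintype S] [DecidableEq S] in
/-- The weighted three-term square bound used in the hub comparison: `w(a+b+c)² ≤ w·3(a²+b²+c²)` for `w ≥ 0`. [ours] -/
theorem mul_sq_add_add_le_three {w : ℝ} (hw : 0 ≤ w) (a b c : ℝ) : w * (a + b + c) ^ 2 ≤ w * (3 * (a ^ 2 + b ^ 2 + c ^ 2)) :=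
  mul_le_mul_of_nonneg_left (by nlinarith [sq_nonneg (a - b), sq_nonneg (b - c), sq_nonneg (a - c)]) hw

omit [Fintype S] [DecidableEq S] in
/-- With the identity map the edge swap is the plain exchange `x ∘ swap i l` (`i ≠ l`). [ours] -/
theorem edgeFlowSwap_one {i l : Fin (K + 1)} (hil : i ≠ l) (x : Fin (K + 1) → S) :
    edgeFlowSwap (Equiv.refl S) i l x = x ∘ Equiv.swap i l := by
  funext j
  simp only [Function.comp_apply]
  by_cases h2 : j = l
  · subst h2; rw [edgeFlowSwap_snd, Equiv.swap_apply_right]; rfl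
  · by_cases h1 : j = i
    · subst h1; rw [edgeFlowSwap_fst _ hil, Equiv.swap_apply_left]; rfl
    · rw [edgeFlowSwap_of_ne _ i l x h1 h2, Equiv.swap_apply_of_ne_of_ne h1 h2]

omit [Fintype S] [DecidableEq S] in
/-- **The star conveyor identity:** `x^{k+1←v} = ((x∘τ_k)^{0←v})∘τ_k`. [ours] -/
theorem update_succ_eq_conj_swap [DecidableEq S] (x : Fin (K + 1) → S) (k : Fin K) (v : S) :
    update x k.succ v
      = (update (x ∘ Equiv.swap (0 : Fin (K + 1)) k.succ) 0 v) ∘ Equiv.swap (0 : Fin (K + 1)) k.succ := by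
  have hne : (0 : Fin (K + 1)) ≠ k.succ := (Fin.succ_ne_zero k).symm
  funext i
  simp only [Function.comp_apply]
  by_cases h1 : i = k.succ
  · subst h1; rw [update_self, Equiv.swap_apply_right, update_self]
  · by_cases h0 : i = 0
    · subst h0
      rw [update_of_ne hne, Equiv.swap_apply_left, update_of_ne (Ne.symm hne), Function.comp_apply,
        Equiv.swap_apply_right]
    · rw [update_of_ne h1, Equiv.swap_apply_of_ne_of_ne h0 h1, update_of_ne h0, Function.comp_apply,
        Equiv.swap_apply_of_ne_of_ne h0 h1]

omit [Fintype S] [DecidableEq S] in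
/-- Distinct star swaps of a state give distinct states unless they fix it. [ours] -/
theorem comp_starSwap_injOn [DecidableEq S] (z : Fin (K + 1) → S) :
    Set.InjOn (fun k : Fin K => z ∘ Equiv.swap (0 : Fin (K + 1)) k.succ)
      ↑(univ.filter fun k : Fin K => z ∘ Equiv.swap (0 : Fin (K + 1)) k.succ ≠ z) := by
  intro k hk k' _ hkk
  simp only [coe_filter, mem_univ, true_and, Set.mem_setOf_eq] at hk
  by_contra hne
  have hne' : (k.succ : Fin (K + 1)) ≠ k'.succ := fun e => hne (Fin.succ_injective _ e)
  simp only at hkk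
  have e1 := congrFun hkk 0
  have e2 := congrFun hkk k.succ
  simp only [Function.comp_apply, Equiv.swap_apply_left, Equiv.swap_apply_right] at e1 e2
  rw [Equiv.swap_apply_of_ne_of_ne (Fin.succ_ne_zero k) hne'] at e2
  apply hk
  funext i
  simp only [Function.comp_apply]
  by_cases h0 : i = 0
  · subst h0; rw [Equiv.swap_apply_left]; exact e2.symm
  · by_cases h1 : i = k.succ
    · subst h1; rw [Equiv.swap_apply_right]; exact e2
    · rw [Equiv.swap_apply_of_ne_of_ne h0 h1]

/-- **The star swap edges are kept:** for `π ≥ 0`, `Q ≥ 0`,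
`½Σ_k Σ_z π(z)Q(z, z∘τ_k)(f z − f(z∘τ_k))² ≤ 𝓔_π(Q; f)`. [ours] -/
theorem half_sum_starSwap_le_dirichletForm {π : (Fin (K + 1) → S) → ℝ} (hπ : ∀ z, 0 ≤ π z)
    {Q : Matrix (Fin (K + 1) → S) (Fin (K + 1) → S) ℝ} (hQ : ∀ z y, 0 ≤ Q z y) (f : (Fin (K + 1) → S) → ℝ) :
    (1 / 2) * ∑ k : Fin K, ∑ z, π z * Q z (z ∘ Equiv.swap (0 : Fin (K + 1)) k.succ)
        * (f z - f (z ∘ Equiv.swap (0 : Fin (K + 1)) k.succ)) ^ 2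
      ≤ dirichletForm π Q f := by
  unfold dirichletForm
  rw [sum_comm]
  refine mul_le_mul_of_nonneg_left (sum_le_sum fun z _ => ?_) (by norm_num)
  set F : (Fin (K + 1) → S) → ℝ := fun y => π z * Q z y * (f z - f y) ^ 2 with hF
  have hF0 : ∀ y, 0 ≤ F y := fun y => mul_nonneg (mul_nonneg (hπ z) (hQ z y)) (sq_nonneg _)
  set s := univ.filter fun k : Fin K => z ∘ Equiv.swap (0 : Fin (K + 1)) k.succ ≠ z with hs
  have h1 : ∑ k : Fin K, F (z ∘ Equiv.swap (0 : Fin (K + 1)) k.succ)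
      = ∑ k ∈ s, F (z ∘ Equiv.swap (0 : Fin (K + 1)) k.succ) := by
    rw [hs, sum_filter]
    refine sum_congr rfl fun k _ => ?_
    split_ifs with h
    · rfl
    · rw [not_not] at h
      rw [h, hF]
      simp
  have h2 : ∑ k ∈ s, F (z ∘ Equiv.swap (0 : Fin (K + 1)) k.succ)
      = ∑ y ∈ s.image (fun k : Fin K => z ∘ Equiv.swap (0 : Fin (K + 1)) k.succ), F y :=
    (sum_image (comp_starSwap_injOn z)).symm
  change ∑ k : Fin K, F (z ∘ Equiv.swap (0 : Fin (K + 1)) k.succ) ≤ ∑ y, F y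
  rw [h1, h2]
  exact sum_le_sum_of_subset_of_nonneg (subset_univ _) fun y _ _ => hF0 y

/-- **Hub swap flows:** for a swap graph `e` (identity maps, distinct endpoints) containing the hub edge
`e_j = (0, k+1)`: `π̃(x)·P(x, x∘τ_k) ≥ (t/m)·min{π̃(x), π̃(x∘τ_k)}` for `x∘τ_k ≠ x` (`0 ≤ t ≤ 1`). [ours] -/
theorem hub_swap_flow_ge {m : ℕ} (e : Fin m → Fin (K + 1) × Fin (K + 1)) (he : ∀ j, (e j).1 ≠ (e j).2)
    (hμ : ∀ k x, 0 < μ k x) (hM : ∀ k, IsRowStochastic (M k)) (ht0 : 0 ≤ t) (ht1 : t ≤ 1)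
    (x : Fin (K + 1) → S) {k : Fin K} {j : Fin m} (hj : e j = ((0 : Fin (K + 1)), k.succ))
    (hx : x ∘ Equiv.swap (0 : Fin (K + 1)) k.succ ≠ x) :
    t / m * min (tensorFun μ x) (tensorFun μ (x ∘ Equiv.swap (0 : Fin (K + 1)) k.succ))
      ≤ tensorFun μ x * ptGraphSampler t μ M e (fun _ : Fin m => Equiv.refl S) x
          (x ∘ Equiv.swap (0 : Fin (K + 1)) k.succ) := by
  have hU := prodKernel_isRowStochastic M (fun _ : Fin (K + 1) => (1 : ℝ) / (K + 1)) (fun _ => by positivity)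
    (sum_uniform_weight K) hM
  have hT := ptGraphProposal_edge_ge e (fun _ : Fin m => Equiv.refl S) j x
  rw [hj] at hT
  simp only at hT
  rw [edgeFlowSwap_one (Fin.succ_ne_zero k).symm] at hT
  rw [ptGraphSampler_apply, mul_add, ← mul_assoc, mul_comm (tensorFun μ x) t, mul_assoc,
    tensorFun_mul_ptGraphSwap hμ he hx]
  have hmin : 0 ≤ min (tensorFun μ x) (tensorFun μ (x ∘ Equiv.swap (0 : Fin (K + 1)) k.succ)) :=
    le_min (tensorFun_pos hμ _).le (tensorFun_pos hμ _).le
  have hupd : 0 ≤ tensorFun μ x * ((1 - t) * prodKernel (fun _ : Fin (K + 1) => (1 : ℝ) / (K + 1)) M x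
      (x ∘ Equiv.swap (0 : Fin (K + 1)) k.succ)) := mul_nonneg (tensorFun_pos hμ x).le (mul_nonneg (by linarith) (hU.1 _ _))
  calc t / m * min (tensorFun μ x) (tensorFun μ (x ∘ Equiv.swap (0 : Fin (K + 1)) k.succ))
      = t * ((1 / m) * min (tensorFun μ x) (tensorFun μ (x ∘ Equiv.swap (0 : Fin (K + 1)) k.succ))) := by ring
    _ ≤ t * (ptGraphProposal e (fun _ : Fin m => Equiv.refl S) x (x ∘ Equiv.swap (0 : Fin (K + 1)) k.succ)
          * min (tensorFun μ x) (tensorFun μ (x ∘ Equiv.swap (0 : Fin (K + 1)) k.succ))) :=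
        mul_le_mul_of_nonneg_left (mul_le_mul_of_nonneg_right hT hmin) ht0
    _ ≤ _ := le_add_of_nonneg_right hupd

/-- **Hot update flows:** `π̃(x)·P(x, x^{0←v}) ≥ ((1−t)/(K+1))·π̃(x)M_0(x_0,v)` for `v ≠ x_0` (`0 ≤ t`; any swap
graph and maps). [ours] -/
theorem hub_hot_flow_ge {m : ℕ} (e : Fin m → Fin (K + 1) × Fin (K + 1)) (φ : Fin m → Equiv.Perm S)
    (hμ : ∀ k x, 0 < μ k x) (ht0 : 0 ≤ t) (x : Fin (K + 1) → S) {v : S} (hv : v ≠ x 0) :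
    (1 - t) / (K + 1) * (tensorFun μ x * M 0 (x 0) v)
      ≤ tensorFun μ x * ptGraphSampler t μ M e φ x (update x 0 v) := by
  rw [ptGraphSampler_apply, prodKernel_update_of_ne _ M x 0 hv]
  have hsw : 0 ≤ t * ptGraphSwap μ e φ x (update x 0 v) := mul_nonneg ht0 ((ptGraphSwap_isRowStochastic hμ).1 _ _)
  calc (1 - t) / (K + 1) * (tensorFun μ x * M 0 (x 0) v)
      = tensorFun μ x * ((1 - t) * ((1 : ℝ) / (K + 1) * M 0 (x 0) v)) := by ring
    _ ≤ _ := mul_le_mul_of_nonneg_left (le_add_of_nonneg_left hsw) (tensorFun_pos hμ x).le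

/-! ## §2 The hub Poincaré inequality and the gap floors -/

/-- **THE HUB POINCARÉ INEQUALITY:** for a swap graph with `m ≥ 1` edges (identity maps, distinct endpoints) containing
every hub edge `(0, k+1)`: `C·Var_π̃(f) ≤ 𝓔_π̃(P; f)` with
`C = 1/(3m(r²+1)/(t r⁴) + (K+1)(r³+3K)/(r³γ₀(1−t)))` — two-sided ratio `r`, hot Poincaré constant `γ₀`, arbitrary
cold updates. [ours] -/
theorem ptHub_poincare {m : ℕ} (hm : 1 ≤ m) (e : Fin m → Fin (K + 1) × Fin (K + 1)) (he : ∀ j, (e j).1 ≠ (e j).2)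
    (hhub : ∀ k : Fin K, ∃ j, e j = ((0 : Fin (K + 1)), k.succ)) (hμ : ∀ k x, 0 < μ k x)
    (hμ1 : ∀ k, ∑ u, μ k u = 1) (hM : ∀ k, IsRowStochastic (M k)) (ht0 : 0 < t) (ht1 : t < 1) {r γ₀ : ℝ}
    (hr : 0 < r) (hr1 : r ≤ 1) (hγ₀ : 0 < γ₀)
    (hrc : ∀ (k : Fin K) (u : S), r * μ 0 u ≤ μ k.succ u) (hrh : ∀ (k : Fin K) (u : S), r * μ k.succ u ≤ μ 0 u)
    (hgap0 : ∀ h : S → ℝ, γ₀ * lawVariance (μ 0) h ≤ dirichletForm (μ 0) (M 0) h) (f : (Fin (K + 1) → S) → ℝ) :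
    1 / (3 * m * (r ^ 2 + 1) / (t * r ^ 4) + (K + 1) * (r ^ 3 + 3 * K) / (r ^ 3 * γ₀ * (1 - t)))
        * lawVariance (tensorFun μ) f
      ≤ dirichletForm (tensorFun μ) (ptGraphSampler t μ M e (fun _ : Fin m => Equiv.refl S)) f := by
  set P := ptGraphSampler t μ M e (fun _ : Fin m => Equiv.refl S) with hP
  have hmpos : (0 : ℝ) < m := Nat.cast_pos.mpr (by omega)
  have hP0 : ∀ x y, 0 ≤ P x y := (ptGraphSampler_isRowStochastic hμ hM ht0.le ht1.le).1
  have hπ0 : ∀ x, 0 ≤ tensorFun μ x := fun x => (tensorFun_pos hμ x).le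
  set W : Fin K → ℝ := fun k => ∑ x : Fin (K + 1) → S, tensorFun μ x
    * (f x - f (x ∘ Equiv.swap (0 : Fin (K + 1)) k.succ)) ^ 2 with hW
  set Sk : Fin K → ℝ := fun k => ∑ x : Fin (K + 1) → S, tensorFun μ x * P x (x ∘ Equiv.swap (0 : Fin (K + 1)) k.succ)
    * (f x - f (x ∘ Equiv.swap (0 : Fin (K + 1)) k.succ)) ^ 2 with hSk
  set U : ℝ := ∑ x : Fin (K + 1) → S, ∑ v, tensorFun μ x * M 0 (x 0) v * (f x - f (update x 0 v)) ^ 2 with hU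
  set H : ℝ := (1 / 2) * ∑ x : Fin (K + 1) → S, ∑ v, tensorFun μ x * P x (update x 0 v) * (f x - f (update x 0 v)) ^ 2
    with hH
  set E := dirichletForm (tensorFun μ) P f with hE
  -- (F5) `W_k ≤ (m/(t r²))·S_k`
  have F5 : ∀ k, W k ≤ m / (t * r ^ 2) * Sk k := by
    intro k
    obtain ⟨j, hj⟩ := hhub k
    rw [hW, hSk]; simp only
    rw [Finset.mul_sum]
    refine sum_le_sum fun x _ => ?_
    by_cases hx : x ∘ Equiv.swap (0 : Fin (K + 1)) k.succ = x
    · rw [hx, sub_self]; simp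
    · have hflow := hub_swap_flow_ge (M := M) e he hμ hM ht0.le ht1.le x hj hx
      have hr2 := tensorFun_comp_swap_zero_succ_ge hμ hr.le hrc hrh x k
      have hmin : r ^ 2 * tensorFun μ x ≤ min (tensorFun μ x) (tensorFun μ (x ∘ Equiv.swap (0 : Fin (K + 1)) k.succ)) :=
        le_min (by nlinarith [tensorFun_pos hμ x, pow_le_one₀ (n := 2) hr.le hr1]) hr2
      have key : t / m * (r ^ 2 * tensorFun μ x) ≤ tensorFun μ x * P x (x ∘ Equiv.swap (0 : Fin (K + 1)) k.succ) :=
        le_trans (mul_le_mul_of_nonneg_left hmin (by positivity)) hflow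
      have hsq := sq_nonneg (f x - f (x ∘ Equiv.swap (0 : Fin (K + 1)) k.succ))
      calc tensorFun μ x * (f x - f (x ∘ Equiv.swap (0 : Fin (K + 1)) k.succ)) ^ 2
          = m / (t * r ^ 2) * (t / m * (r ^ 2 * tensorFun μ x))
            * (f x - f (x ∘ Equiv.swap (0 : Fin (K + 1)) k.succ)) ^ 2 := by field_simp
        _ ≤ m / (t * r ^ 2) * (tensorFun μ x * P x (x ∘ Equiv.swap (0 : Fin (K + 1)) k.succ))
            * (f x - f (x ∘ Equiv.swap (0 : Fin (K + 1)) k.succ)) ^ 2 :=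
          mul_le_mul_of_nonneg_right (mul_le_mul_of_nonneg_left key (by positivity)) hsq
        _ = _ := by ring
  -- (F6) `U ≤ (2(K+1)/(1−t))·H`
  have F6 : U ≤ 2 * (K + 1) / (1 - t) * H := by
    rw [hU, hH, ← mul_assoc, show 2 * ((K : ℝ) + 1) / (1 - t) * (1 / 2) = (K + 1) / (1 - t) by ring, Finset.mul_sum]
    refine sum_le_sum fun x _ => ?_
    rw [Finset.mul_sum]
    refine sum_le_sum fun v _ => ?_
    by_cases hv : v = x 0
    · rw [hv, update_eq_self, sub_self]; simp
    · have hflow := hub_hot_flow_ge (M := M) e (fun _ : Fin m => Equiv.refl S) hμ ht0.le x hv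
      have hsq := sq_nonneg (f x - f (update x 0 v))
      have h1t : 0 < 1 - t := by linarith
      calc tensorFun μ x * M 0 (x 0) v * (f x - f (update x 0 v)) ^ 2
          = (K + 1) / (1 - t) * ((1 - t) / (K + 1) * (tensorFun μ x * M 0 (x 0) v)) * (f x - f (update x 0 v)) ^ 2 := by
            field_simp
        _ ≤ (K + 1) / (1 - t) * (tensorFun μ x * P x (update x 0 v)) * (f x - f (update x 0 v)) ^ 2 :=
            mul_le_mul_of_nonneg_right (mul_le_mul_of_nonneg_left hflow (by positivity)) hsq
        _ = _ := by ring
  -- (F7) kept flows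
  have F7a : (1 / 2) * ∑ k, Sk k ≤ E := by
    rw [hSk, hE]; exact half_sum_starSwap_le_dirichletForm hπ0 hP0 f
  have F7b : H ≤ E := by rw [hH, hE]; exact half_sum_relabel_le_dirichletForm hπ0 hP0 f
  -- Efron–Stein and the legs
  have ES := efronStein_tensorFun (ν := μ) (fun k u => (hμ k u).le) hμ1 f
  rw [Fin.sum_univ_succ] at ES
  have B0 : (1 / 2) * ∑ x : Fin (K + 1) → S, ∑ v, tensorFun μ x * μ 0 v * (f x - f (update x 0 v)) ^ 2
      ≤ 1 / (2 * γ₀) * U := by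
    have h := star_hot_variance_le (μ := μ) hμ1 (fun k u => (hμ k u).le) hγ₀ hgap0 f
    rw [hU]
    calc (1 / 2) * ∑ x : Fin (K + 1) → S, ∑ v, tensorFun μ x * μ 0 v * (f x - f (update x 0 v)) ^ 2
        ≤ (1 / 2) * (1 / γ₀ * ∑ y : Fin (K + 1) → S, ∑ v, tensorFun μ y * M 0 (y 0) v * (f y - f (update y 0 v)) ^ 2) :=
          mul_le_mul_of_nonneg_left h (by norm_num)
      _ = _ := by ring
  have Bk : ∀ k : Fin K, (1 / 2) * ∑ x : Fin (K + 1) → S, ∑ v, tensorFun μ x * μ k.succ v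
      * (f x - f (update x k.succ v)) ^ 2 ≤ 3 / 2 * ((1 + 1 / r ^ 2) * W k + 1 / (r ^ 3 * γ₀) * U) := by
    intro k
    have L1 := star_leg_swap (μ := μ) hμ1 f k
    have L2 := star_leg_hot_le (μ := μ) hμ hμ1 hr hr1 hγ₀ hrc hrh hgap0 f k
    have L3 := star_leg_back_le (μ := μ) hμ hμ1 hr hrc hrh f k
    -- pointwise three-step split
    have split : ∀ (x : Fin (K + 1) → S) (v : S), tensorFun μ x * μ k.succ v * (f x - f (update x k.succ v)) ^ 2
        ≤ 3 * (tensorFun μ x * μ k.succ v * (f x - f (x ∘ Equiv.swap (0 : Fin (K + 1)) k.succ)) ^ 2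
          + tensorFun μ x * μ k.succ v * (f (x ∘ Equiv.swap (0 : Fin (K + 1)) k.succ)
              - f (update (x ∘ Equiv.swap (0 : Fin (K + 1)) k.succ) 0 v)) ^ 2
          + tensorFun μ x * μ k.succ v * (f (update (x ∘ Equiv.swap (0 : Fin (K + 1)) k.succ) 0 v)
              - f ((update (x ∘ Equiv.swap (0 : Fin (K + 1)) k.succ) 0 v) ∘ Equiv.swap (0 : Fin (K + 1)) k.succ)) ^ 2) := by
      intro x v
      rw [update_succ_eq_conj_swap x k v]
      have hw : 0 ≤ tensorFun μ x * μ k.succ v := mul_nonneg (hπ0 x) (hμ _ _).le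
      have h3 := mul_sq_add_add_le_three hw (f x - f (x ∘ Equiv.swap (0 : Fin (K + 1)) k.succ))
        (f (x ∘ Equiv.swap (0 : Fin (K + 1)) k.succ) - f (update (x ∘ Equiv.swap (0 : Fin (K + 1)) k.succ) 0 v))
        (f (update (x ∘ Equiv.swap (0 : Fin (K + 1)) k.succ) 0 v)
          - f ((update (x ∘ Equiv.swap (0 : Fin (K + 1)) k.succ) 0 v) ∘ Equiv.swap (0 : Fin (K + 1)) k.succ))
      have e : f x - f ((update (x ∘ Equiv.swap (0 : Fin (K + 1)) k.succ) 0 v) ∘ Equiv.swap (0 : Fin (K + 1)) k.succ)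
          = (f x - f (x ∘ Equiv.swap (0 : Fin (K + 1)) k.succ))
            + (f (x ∘ Equiv.swap (0 : Fin (K + 1)) k.succ) - f (update (x ∘ Equiv.swap (0 : Fin (K + 1)) k.succ) 0 v))
            + (f (update (x ∘ Equiv.swap (0 : Fin (K + 1)) k.succ) 0 v)
              - f ((update (x ∘ Equiv.swap (0 : Fin (K + 1)) k.succ) 0 v) ∘ Equiv.swap (0 : Fin (K + 1)) k.succ)) := by
        ring
      rw [e]
      nlinarith [h3]
    have hsum := sum_le_sum fun x (_ : x ∈ (univ : Finset (Fin (K + 1) → S))) =>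
      sum_le_sum fun v (_ : v ∈ (univ : Finset S)) => split x v
    have e : ∑ x : Fin (K + 1) → S, ∑ v : S,
        3 * (tensorFun μ x * μ k.succ v * (f x - f (x ∘ Equiv.swap (0 : Fin (K + 1)) k.succ)) ^ 2
          + tensorFun μ x * μ k.succ v * (f (x ∘ Equiv.swap (0 : Fin (K + 1)) k.succ)
              - f (update (x ∘ Equiv.swap (0 : Fin (K + 1)) k.succ) 0 v)) ^ 2
          + tensorFun μ x * μ k.succ v * (f (update (x ∘ Equiv.swap (0 : Fin (K + 1)) k.succ) 0 v)
              - f ((update (x ∘ Equiv.swap (0 : Fin (K + 1)) k.succ) 0 v) ∘ Equiv.swap (0 : Fin (K + 1)) k.succ)) ^ 2)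
        = 3 * (∑ x : Fin (K + 1) → S, ∑ v : S,
            tensorFun μ x * μ k.succ v * (f x - f (x ∘ Equiv.swap (0 : Fin (K + 1)) k.succ)) ^ 2
          + ∑ x : Fin (K + 1) → S, ∑ v : S, tensorFun μ x * μ k.succ v * (f (x ∘ Equiv.swap (0 : Fin (K + 1)) k.succ)
              - f (update (x ∘ Equiv.swap (0 : Fin (K + 1)) k.succ) 0 v)) ^ 2
          + ∑ x : Fin (K + 1) → S, ∑ v : S, tensorFun μ x * μ k.succ v
              * (f (update (x ∘ Equiv.swap (0 : Fin (K + 1)) k.succ) 0 v)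
                - f ((update (x ∘ Equiv.swap (0 : Fin (K + 1)) k.succ) 0 v) ∘ Equiv.swap (0 : Fin (K + 1)) k.succ)) ^ 2) := by
      simp only [Finset.mul_sum, mul_add, Finset.sum_add_distrib]
    rw [e, L1] at hsum
    have hr2 : 0 < r ^ 2 := by positivity
    nlinarith [hsum, L2, L3]
  -- assemble
  have h1t : 0 < 1 - t := by linarith
  set A : ℝ := 3 * m * (r ^ 2 + 1) / (t * r ^ 4) with hA
  set B : ℝ := (K + 1) * (r ^ 3 + 3 * K) / (r ^ 3 * γ₀ * (1 - t)) with hB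
  have hApos : 0 < A := by positivity
  have hBpos : 0 < B := div_pos (by positivity) (mul_pos (by positivity) h1t)
  have hE0 : 0 ≤ E := by rw [hE]; exact dirichletForm_nonneg hπ0 hP0 f
  set c1 : ℝ := 3 / 2 * (1 + 1 / r ^ 2) * (m / (t * r ^ 2)) with hc1
  set c2 : ℝ := 3 / 2 * (1 / (r ^ 3 * γ₀)) with hc2
  have hc1pos : 0 ≤ c1 := by positivity
  have step2 : ∀ k : Fin K, (1 / 2) * ∑ x : Fin (K + 1) → S, ∑ v, tensorFun μ x * μ k.succ v
      * (f x - f (update x k.succ v)) ^ 2 ≤ c1 * Sk k + c2 * U := by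
    intro k
    have h1r : 0 ≤ 3 / 2 * (1 + 1 / r ^ 2) := by positivity
    have := mul_le_mul_of_nonneg_left (F5 k) h1r
    rw [hc1, hc2]; nlinarith [Bk k, this]
  have step3 : ∑ k : Fin K, (1 / 2) * ∑ x : Fin (K + 1) → S, ∑ v, tensorFun μ x * μ k.succ v
      * (f x - f (update x k.succ v)) ^ 2 ≤ c1 * ∑ k, Sk k + K * (c2 * U) := by
    calc ∑ k : Fin K, (1 / 2) * ∑ x : Fin (K + 1) → S, ∑ v, tensorFun μ x * μ k.succ v
          * (f x - f (update x k.succ v)) ^ 2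
        ≤ ∑ k : Fin K, (c1 * Sk k + c2 * U) := sum_le_sum fun k _ => step2 k
      _ = c1 * ∑ k, Sk k + K * (c2 * U) := by
          rw [Finset.sum_add_distrib, Finset.sum_const, Finset.card_univ, Fintype.card_fin, nsmul_eq_mul,
            ← Finset.mul_sum]
  have hSsum : ∑ k, Sk k ≤ 2 * E := by linarith [F7a]
  have hUH : U ≤ 2 * (K + 1) / (1 - t) * E :=
    le_trans F6 (mul_le_mul_of_nonneg_left F7b (div_nonneg (by positivity) h1t.le))
  have hc2' : 0 ≤ 1 / (2 * γ₀) + K * c2 := by positivity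
  have hVar : lawVariance (tensorFun μ) f ≤ (A + B) * E :=
    calc lawVariance (tensorFun μ) f
        ≤ 1 / (2 * γ₀) * U + (c1 * ∑ k, Sk k + K * (c2 * U)) := le_trans ES (add_le_add B0 step3)
      _ = c1 * ∑ k, Sk k + (1 / (2 * γ₀) + K * c2) * U := by ring
      _ ≤ c1 * (2 * E) + (1 / (2 * γ₀) + K * c2) * (2 * (K + 1) / (1 - t) * E) :=
          add_le_add (mul_le_mul_of_nonneg_left hSsum hc1pos) (mul_le_mul_of_nonneg_left hUH hc2')
      _ = (A + B) * E := by
          rw [hA, hB, hc1, hc2]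
          field_simp
  have hAB : 0 < A + B := add_pos hApos hBpos
  rw [hA, hB] at hVar hAB
  rw [one_div, inv_mul_le_iff₀ hAB]; exact hVar

/-- **THE HUB FLOOR: `Gap(P) ≥ 1/(3m(r²+1)/(t r⁴) + (K+1)(r³+3K)/(r³γ₀(1−t)))`** for every swap graph with `m ≥ 1`
edges (identity maps, distinct endpoints) containing the hub edges (`0 < t < 1`, `|S| ≥ 2`, cold updates arbitrary
`μ_k`-reversible).  For the complete graph (`m = K(K+1)/2`) this is still order `K⁻²`. [ours] -/
theorem ptHub_spectralGap_ge [Nontrivial S] {m : ℕ} (hm : 1 ≤ m) (e : Fin m → Fin (K + 1) × Fin (K + 1))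
    (he : ∀ j, (e j).1 ≠ (e j).2) (hhub : ∀ k : Fin K, ∃ j, e j = ((0 : Fin (K + 1)), k.succ))
    (hμ : ∀ k x, 0 < μ k x) (hμ1 : ∀ k, ∑ u, μ k u = 1) (hM : ∀ k, IsRowStochastic (M k))
    (hMrev : ∀ k, DetailedBalance (μ k) (M k)) (ht0 : 0 < t) (ht1 : t < 1) {r γ₀ : ℝ} (hr : 0 < r) (hr1 : r ≤ 1)
    (hγ₀ : 0 < γ₀) (hrc : ∀ (k : Fin K) (u : S), r * μ 0 u ≤ μ k.succ u)
    (hrh : ∀ (k : Fin K) (u : S), r * μ k.succ u ≤ μ 0 u)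
    (hgap0 : ∀ h : S → ℝ, γ₀ * lawVariance (μ 0) h ≤ dirichletForm (μ 0) (M 0) h) :
    1 / (3 * m * (r ^ 2 + 1) / (t * r ^ 4) + (K + 1) * (r ^ 3 + 3 * K) / (r ^ 3 * γ₀ * (1 - t)))
      ≤ spectralGap (tensorFun μ) (ptGraphSampler t μ M e (fun _ : Fin m => Equiv.refl S)) :=
  le_spectralGap_of_poincare (tensorFun_pos hμ) (sum_tensorFun_eq_one μ hμ1)
    (ptGraphSampler_isRowStochastic hμ hM ht0.le ht1.le) (ptGraphSampler_detailedBalance hμ hMrev)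
    (ptHub_poincare hm e he hhub hμ hμ1 hM ht0 ht1 hr hr1 hγ₀ hrc hrh hgap0)

/-- **THE STAR FLOOR: `Gap(P) ≥ 1/(3K(r²+1)/(t r⁴) + (K+1)(r³+3K)/(r³γ₀(1−t)))`** for the star sampler (edges
`(0, k+1)`, identity maps; `K ≥ 1`, `0 < t < 1`, `|S| ≥ 2`, cold updates arbitrary `μ_k`-reversible). [ours] -/
theorem ptStar_spectralGap_ge [Nontrivial S] (hK : 1 ≤ K) (hμ : ∀ k x, 0 < μ k x) (hμ1 : ∀ k, ∑ u, μ k u = 1)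
    (hM : ∀ k, IsRowStochastic (M k)) (hMrev : ∀ k, DetailedBalance (μ k) (M k)) (ht0 : 0 < t) (ht1 : t < 1)
    {r γ₀ : ℝ} (hr : 0 < r) (hr1 : r ≤ 1) (hγ₀ : 0 < γ₀)
    (hrc : ∀ (k : Fin K) (u : S), r * μ 0 u ≤ μ k.succ u) (hrh : ∀ (k : Fin K) (u : S), r * μ k.succ u ≤ μ 0 u)
    (hgap0 : ∀ h : S → ℝ, γ₀ * lawVariance (μ 0) h ≤ dirichletForm (μ 0) (M 0) h) :
    1 / (3 * K * (r ^ 2 + 1) / (t * r ^ 4) + (K + 1) * (r ^ 3 + 3 * K) / (r ^ 3 * γ₀ * (1 - t)))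
      ≤ spectralGap (tensorFun μ) (ptGraphSampler t μ M (fun k : Fin K => ((0 : Fin (K + 1)), k.succ))
          (fun _ : Fin K => Equiv.refl S)) :=
  ptHub_spectralGap_ge hK (fun k : Fin K => ((0 : Fin (K + 1)), k.succ)) (fun k => (Fin.succ_ne_zero k).symm)
    (fun k => ⟨k, rfl⟩) hμ hμ1 hM hMrev ht0 ht1 hr hr1 hγ₀ hrc hrh hgap0

/-- **IDENTICAL LEVELS: `Gap(P) ≥ 1/(6K/t + (K+1)(3K+1)/(γ₀(1−t)))`** for the star sampler with `μ_k = μ_0`, hot Poincaré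
constant `γ₀` and ARBITRARY cold updates — with the ceiling `(1−t)Q_0(A,Aᶜ)/((K+1)Kv)` for sector-frozen cold
replicas (`Scaling/ReplicaExchangeGraphSwapDiffusive` §4) the star relaxes in `Θ(K²)` steps. [ours] -/
theorem ptStarIdentical_spectralGap_ge [Nontrivial S] (hK : 1 ≤ K) (hμ : ∀ k x, 0 < μ k x)
    (hμ1 : ∀ k, ∑ u, μ k u = 1) (hM : ∀ k, IsRowStochastic (M k)) (hMrev : ∀ k, DetailedBalance (μ k) (M k))
    (ht0 : 0 < t) (ht1 : t < 1) (hsame : ∀ k, μ k = μ 0) {γ₀ : ℝ} (hγ₀ : 0 < γ₀)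
    (hgap0 : ∀ h : S → ℝ, γ₀ * lawVariance (μ 0) h ≤ dirichletForm (μ 0) (M 0) h) :
    1 / (6 * K / t + (K + 1) * (3 * K + 1) / (γ₀ * (1 - t)))
      ≤ spectralGap (tensorFun μ) (ptGraphSampler t μ M (fun k : Fin K => ((0 : Fin (K + 1)), k.succ))
          (fun _ : Fin K => Equiv.refl S)) := by
  have h := ptStar_spectralGap_ge (t := t) (M := M) (r := 1) hK hμ hμ1 hM hMrev ht0 ht1 one_pos le_rfl hγ₀
    (fun k u => by rw [hsame k.succ, one_mul]) (fun k u => by rw [hsame k.succ, one_mul]) hgap0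
  have e : 3 * (K : ℝ) * ((1 : ℝ) ^ 2 + 1) / (t * 1 ^ 4) + (K + 1) * (1 ^ 3 + 3 * K) / (1 ^ 3 * γ₀ * (1 - t))
      = 6 * K / t + (K + 1) * (3 * K + 1) / (γ₀ * (1 - t)) := by ring
  exact e ▸ h

end Summit.Ventures.LatticeQCDFlow.Scaling

end
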